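import Literature.AlgebraicGeometry.HodgeTheory.WeilClassesSurfacesProofs
import HarnessLib

/-!
# Symmetries of the companion square `E × E`: sign changes and the swap, on the torus and in `H²`

Continuation of `WeilSurfaceSquareModel` / `WeilClassesSurfacesProofs` (the companion Weil surface
`B = E_τ × E_τ`, its analytification `φ : T = ℂ²/(ℤ + τℤ)² ≅ B(ℂ)`). Inputs for
`WeilClassesSurfacesAlgebraic` (the Weil class is an algebraic divisor class):

* `WeilSquare.swapAV`, `sqMap_comp_swap`, `torusMap_swap` — the swap of the two factors is, on `T`, the
  block swap `(0 2)(1 3)` of the lattice basis (`ComplexTorus.mapMatrix` of a permutation matrix);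
* `map_fst_torusMap_flip`, `map_snd_torusMap_flip` — the sign changes `x_q ↦ -x_q` of the lattice basis
  in the second (first) block do not move the first (second) factor;
* `repr_eq_zero_of_fixed`, `exists_eq_smul_of_fixed_two_three`, `exists_eq_smul_of_fixed_zero_one` —
  the sign changes act DIAGONALLY on the singular basis `e[dx_a ∧ dx_b]` of `H²(T; ℂ)`
  (`torusPullback_e_latMonomial`), so a class fixed by `x₂ ↦ -x₂` and `x₃ ↦ -x₃` is a multiple of
  `e[dx₀ ∧ dx₁]`, and one fixed by `x₀ ↦ -x₀`, `x₁ ↦ -x₁` a multiple of `e[dx₂ ∧ dx₃]`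
  (Lange–Birkenhake (1992), §1.1.2–§1.1.4: automorphisms of the lattice act on `Hᵏ = ⋀ᵏ Hom(Λ, ℤ)`).

Everything is proved; no named fact is introduced.

## References

* H. Lange, Ch. Birkenhake, *Complex Abelian Varieties* (1992), §1.1.2, §1.1.4. [LangeBirkenhake1992]
-/

noncomputable section

open CategoryTheory MonoidalCategory CartesianMonoidalCategory
open scoped Manifold ContDiff ComplexConjugate
open Literature.AlgebraicGeometry.Motives Literature.Geometry.Kaehler Literature.NumberTheory.Transcendental
open Literature.AlgebraicTopology.SingularHomology
open Literature.Barriers.HodgeConjecture (signedPermMatrix)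

namespace Literature.AlgebraicGeometry.HodgeTheory

namespace WeilSquare

/-! ### Automorphisms of the torus compatible with the projections and with the swap -/

section Symmetries

variable (τ : ℂ) (hτ : τ.im ≠ 0)

/-- The first projection `E × E → E` (a homomorphism). [folklore] -/
abbrev fstAV : square τ hτ ⟶ curveAV τ hτ := AbelianVariety.fst (curveAV τ hτ) (curveAV τ hτ)

/-- The second projection `E × E → E`. [folklore] -/
abbrev sndAV : square τ hτ ⟶ curveAV τ hτ := AbelianVariety.snd (curveAV τ hτ) (curveAV τ hτ)

/-- The swap of the two factors of `E × E` (a homomorphism). [folklore] -/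
def swapAV : square τ hτ ⟶ square τ hτ := AbelianVariety.prodLift (sndAV τ hτ) (fstAV τ hτ)

/-- `swap ≫ pr₁ = pr₂`. [folklore] -/
theorem swapAV_fst : swapAV τ hτ ≫ fstAV τ hτ = sndAV τ hτ := AbelianVariety.prodLift_fst _ _

/-- `swap ≫ pr₂ = pr₁`. [folklore] -/
theorem swapAV_snd : swapAV τ hτ ≫ sndAV τ hτ = fstAV τ hτ := AbelianVariety.prodLift_snd _ _

/-- `pr₁ (sqMap u) = φ(u₀)` on complex points. [folklore] -/
theorem map_fst_sqMap (u : Fin 2 → ℂ) : AlgPoints.map (fstAV τ hτ).hom.hom.hom (sqMap τ hτ u) = uE τ hτ (u 0) :=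
  congrArg Additive.toMul (sqMap_fst τ hτ u)

/-- `pr₂ (sqMap u) = φ(u₁)` on complex points. [folklore] -/
theorem map_snd_sqMap (u : Fin 2 → ℂ) : AlgPoints.map (sndAV τ hτ).hom.hom.hom (sqMap τ hτ u) = uE τ hτ (u 1) :=
  congrArg Additive.toMul (sqMap_snd τ hτ u)

/-- **The swap acts on the uniformisation by swapping the coordinates.** [folklore] -/
theorem sqMap_comp_swap (u : Fin 2 → ℂ) :
    sqMap τ hτ u ≫ (swapAV τ hτ).hom.hom.hom = sqMap τ hτ ![u 1, u 0] := by
  apply CartesianMonoidalCategory.hom_ext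
  · have h1 := congrArg (evHom (A := curveAV τ hτ) (sqMap τ hτ u)) (swapAV_fst τ hτ)
    rw [sqMap_snd] at h1
    have h2 := sqMap_fst τ hτ ![u 1, u 0]
    rw [evHom_apply] at h1 h2
    have h' := congrArg Additive.toMul (h1.trans h2.symm)
    simp only [toMul_ofMul] at h'
    exact (Category.assoc _ _ _).trans h'
  · have h1 := congrArg (evHom (A := curveAV τ hτ) (sqMap τ hτ u)) (swapAV_snd τ hτ)
    rw [sqMap_fst] at h1
    have h2 := sqMap_snd τ hτ ![u 1, u 0]
    rw [evHom_apply] at h1 h2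
    have h' := congrArg Additive.toMul (h1.trans h2.symm)
    simp only [toMul_ofMul] at h'
    exact (Category.assoc _ _ _).trans h'

/-- The diagonal sign matrix `signedPermMatrix s 1` acts on lattice coordinates by `x_q ↦ s_q x_q`.
[cite: LangeBirkenhake1992, §1.1.2] -/
theorem signedPermMatrix_one_mulVec (s : Fin 4 → ℤ) (x : Fin 4 → ℝ) :
    ((signedPermMatrix s 1).map (Int.cast : ℤ → ℝ)).mulVec x = fun q ↦ (s q : ℝ) * x q := by
  funext q
  simp only [Matrix.mulVec, dotProduct, Matrix.map_apply, signedPermMatrix, Matrix.of_apply,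
    Equiv.Perm.coe_one, id_eq]
  rw [Finset.sum_eq_single q]
  · rw [if_pos rfl]
  · intro b _ hb; rw [if_neg hb, Int.cast_zero, zero_mul]
  · intro h; exact absurd (Finset.mem_univ q) h

/-- The sign change at `q`: `s = (1, …, -1_q, …, 1)`. [cite: LangeBirkenhake1992, §1.1.2] -/
def flipSign (q : Fin 4) : Fin 4 → ℤ := fun r ↦ if r = q then -1 else 1

/-- **Sign changes in the second block do not move the first factor**: for `q ∈ {2, 3}`,
`pr₁ (torusMap (x ↦ s·x)) = pr₁ (torusMap x)`. [cite: LangeBirkenhake1992, §1.1.2] -/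
theorem map_fst_torusMap_flip (q : Fin 4) (hq : q = 2 ∨ q = 3) (t : Torus τ hτ) :
    AlgPoints.map (fstAV τ hτ).hom.hom.hom
        (torusMap τ hτ (ComplexTorus.mapMatrix (periodIso τ hτ) (periodIso τ hτ) (signedPermMatrix (flipSign q) 1) t)) =
      AlgPoints.map (fstAV τ hτ).hom.hom.hom (torusMap τ hτ t) := by
  obtain ⟨z, rfl⟩ := ComplexTorus.cover_surjective (periodIso τ hτ) t
  rw [ComplexTorus.cover_apply, ComplexTorus.mapMatrix_proj, signedPermMatrix_one_mulVec]
  have hc : ComplexTorus.proj (periodIso τ hτ) (fun r ↦ ((flipSign q r : ℤ) : ℝ) * (periodIso τ hτ).symm z r) =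
      ComplexTorus.cover (periodIso τ hτ) (periodIso τ hτ (fun r ↦ ((flipSign q r : ℤ) : ℝ) * (periodIso τ hτ).symm z r)) := by
    rw [ComplexTorus.cover_apply, ContinuousLinearEquiv.symm_apply_apply]
  rw [hc, torusMap_cover, ← ComplexTorus.cover_apply, torusMap_cover, map_fst_sqMap, map_fst_sqMap]
  congr 1
  rw [periodIso_apply_zero]
  conv_rhs => rw [← (periodIso τ hτ).apply_symm_apply z, periodIso_apply_zero]
  have h0 : flipSign q 0 = 1 := by rcases hq with rfl | rfl <;> decide
  have h1 : flipSign q 1 = 1 := by rcases hq with rfl | rfl <;> decide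
  simp [h0, h1]

/-- **Sign changes in the first block do not move the second factor**: for `q ∈ {0, 1}`.
[cite: LangeBirkenhake1992, §1.1.2] -/
theorem map_snd_torusMap_flip (q : Fin 4) (hq : q = 0 ∨ q = 1) (t : Torus τ hτ) :
    AlgPoints.map (sndAV τ hτ).hom.hom.hom
        (torusMap τ hτ (ComplexTorus.mapMatrix (periodIso τ hτ) (periodIso τ hτ) (signedPermMatrix (flipSign q) 1) t)) =
      AlgPoints.map (sndAV τ hτ).hom.hom.hom (torusMap τ hτ t) := by
  obtain ⟨z, rfl⟩ := ComplexTorus.cover_surjective (periodIso τ hτ) t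
  rw [ComplexTorus.cover_apply, ComplexTorus.mapMatrix_proj, signedPermMatrix_one_mulVec]
  have hc : ComplexTorus.proj (periodIso τ hτ) (fun r ↦ ((flipSign q r : ℤ) : ℝ) * (periodIso τ hτ).symm z r) =
      ComplexTorus.cover (periodIso τ hτ) (periodIso τ hτ (fun r ↦ ((flipSign q r : ℤ) : ℝ) * (periodIso τ hτ).symm z r)) := by
    rw [ComplexTorus.cover_apply, ContinuousLinearEquiv.symm_apply_apply]
  rw [hc, torusMap_cover, ← ComplexTorus.cover_apply, torusMap_cover, map_snd_sqMap, map_snd_sqMap]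
  congr 1
  rw [periodIso_apply_one]
  conv_rhs => rw [← (periodIso τ hτ).apply_symm_apply z, periodIso_apply_one]
  have h2 : flipSign q 2 = 1 := by rcases hq with rfl | rfl <;> decide
  have h3 : flipSign q 3 = 1 := by rcases hq with rfl | rfl <;> decide
  simp [h2, h3]

/-- The block swap `(0 2)(1 3)` of the lattice basis. [folklore] -/
def swapPerm : Equiv.Perm (Fin 4) := Equiv.swap 0 2 * Equiv.swap 1 3

/-- Values of the block swap. [folklore] -/
theorem swapPerm_apply : swapPerm 0 = 2 ∧ swapPerm 1 = 3 ∧ swapPerm 2 = 0 ∧ swapPerm 3 = 1 := by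
  unfold swapPerm; decide

/-- The permutation matrix of the block swap acts by `x ↦ (x₂, x₃, x₀, x₁)`. [folklore] -/
theorem swapMatrix_mulVec (x : Fin 4 → ℝ) :
    ((signedPermMatrix (fun _ ↦ (1 : ℤ)) swapPerm).map (Int.cast : ℤ → ℝ)).mulVec x = fun q ↦ x (swapPerm q) := by
  funext q
  simp only [Matrix.mulVec, dotProduct, Matrix.map_apply, signedPermMatrix, Matrix.of_apply]
  rw [Finset.sum_eq_single (swapPerm q)]
  · rw [if_pos rfl, Int.cast_one, one_mul]
  · intro b _ hb; rw [if_neg hb, Int.cast_zero, zero_mul]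
  · intro h; exact absurd (Finset.mem_univ _) h

/-- **The swap of the two factors of `E × E` is, on the torus, the block swap of the lattice basis.**
[cite: LangeBirkenhake1992, §1.1.2] -/
theorem torusMap_swap (t : Torus τ hτ) :
    torusMap τ hτ (ComplexTorus.mapMatrix (periodIso τ hτ) (periodIso τ hτ)
        (signedPermMatrix (fun _ ↦ (1 : ℤ)) swapPerm) t) =
      AlgPoints.map (swapAV τ hτ).hom.hom.hom (torusMap τ hτ t) := by
  obtain ⟨z, rfl⟩ := ComplexTorus.cover_surjective (periodIso τ hτ) t
  rw [ComplexTorus.cover_apply, ComplexTorus.mapMatrix_proj, swapMatrix_mulVec]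
  have hc : ComplexTorus.proj (periodIso τ hτ) (fun r ↦ (periodIso τ hτ).symm z (swapPerm r)) =
      ComplexTorus.cover (periodIso τ hτ) (periodIso τ hτ (fun r ↦ (periodIso τ hτ).symm z (swapPerm r))) := by
    rw [ComplexTorus.cover_apply, ContinuousLinearEquiv.symm_apply_apply]
  rw [hc, torusMap_cover, ← ComplexTorus.cover_apply, torusMap_cover, AlgPoints.map_apply, sqMap_comp_swap]
  obtain ⟨e0, e1, e2, e3⟩ := swapPerm_apply
  congr 1
  funext a
  fin_cases a
  · change periodIso τ hτ _ 0 = (![z 1, z 0] : Fin 2 → ℂ) 0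
    rw [periodIso_apply_zero]
    conv_rhs => rw [show (![z 1, z 0] : Fin 2 → ℂ) 0 = z 1 from rfl, ← (periodIso τ hτ).apply_symm_apply z,
      periodIso_apply_one]
    rw [e0, e1]
  · change periodIso τ hτ _ 1 = (![z 1, z 0] : Fin 2 → ℂ) 1
    rw [periodIso_apply_one]
    conv_rhs => rw [show (![z 1, z 0] : Fin 2 → ℂ) 1 = z 0 from rfl, ← (periodIso τ hτ).apply_symm_apply z,
      periodIso_apply_zero]
    rw [e2, e3]

end Symmetries

/-! ### Fixed vectors of the sign changes in `H²(T; ℂ)` -/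

section Fixed

variable (τ : ℂ) (hτ : τ.im ≠ 0) {e : ComplexDeRhamIsoFamily (Fin 2 → ℂ)} (he : e.IsNatural)

include he in
/-- **The sign change `x_q ↦ -x_q` acts on the singular basis diagonally**, by `-1` on `e[dx_a ∧ dx_b]`
iff `q ∈ {a, b}`. [cite: LangeBirkenhake1992, §1.1.2 and §1.1.4] -/
theorem torusPullback_flip_singBasis (q : Fin 4) (j : Fin 6) :
    torusPullback τ hτ (signedPermMatrix (flipSign q) 1) (singBasis τ hτ e j) =
      ((∏ i, flipSign q (sqWord j i) : ℤ) : ℂ) • singBasis τ hτ e j := by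
  rw [singBasis_apply, deRhamBasis_apply, torusPullback_e_latMonomial τ hτ he]
  rfl

include he in
/-- **A class fixed by a sign change has no component along the basis vectors it negates.**
[cite: LangeBirkenhake1992, §1.1.4] -/
theorem repr_eq_zero_of_fixed (q : Fin 4) {v : singularCohomology ℂ ℂ (Torus τ hτ) 2}
    (hv : torusPullback τ hτ (signedPermMatrix (flipSign q) 1) v = v) (j : Fin 6)
    (hj : (∏ i, flipSign q (sqWord j i)) = -1) : (singBasis τ hτ e).repr v j = 0 := by
  set b := singBasis τ hτ e with hb
  have hexp : v = ∑ i, b.repr v i • b i := (b.sum_repr v).symm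
  have hP : torusPullback τ hτ (signedPermMatrix (flipSign q) 1) v =
      ∑ i, (b.repr v i * ((∏ l, flipSign q (sqWord i l) : ℤ) : ℂ)) • b i := by
    conv_lhs => rw [hexp]
    rw [map_sum]
    refine Finset.sum_congr rfl fun i _ ↦ ?_
    rw [map_smul, hb, torusPullback_flip_singBasis τ hτ he, ← hb, smul_smul]
  have hcoef := congrArg (fun w ↦ b.repr w j) (hP.symm.trans hv)
  simp only [map_sum, map_smul, Module.Basis.repr_self, Finsupp.smul_single, smul_eq_mul, mul_one,
    Finsupp.coe_finsetSum, Finset.sum_apply, Finsupp.single_apply, Finset.sum_ite_eq',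
    Finset.mem_univ, ↓reduceIte] at hcoef
  rw [hj, Int.cast_neg, Int.cast_one, mul_neg, mul_one] at hcoef
  -- `-c = c`
  have h2 : (2 : ℂ) * b.repr v j = 0 := by linear_combination -hcoef
  exact (mul_eq_zero.mp h2).resolve_left two_ne_zero

include he in
/-- **The common fixed space of `x₂ ↦ -x₂` and `x₃ ↦ -x₃` in `H²(T; ℂ)` is the line `ℂ · e[dx₀ ∧ dx₁]`.**
[cite: LangeBirkenhake1992, §1.1.4] -/
theorem exists_eq_smul_of_fixed_two_three {v : singularCohomology ℂ ℂ (Torus τ hτ) 2}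
    (h2 : torusPullback τ hτ (signedPermMatrix (flipSign 2) 1) v = v)
    (h3 : torusPullback τ hτ (signedPermMatrix (flipSign 3) 1) v = v) :
    ∃ κ : ℂ, v = κ • deRhamIso τ hτ e (ComplexTorus.cconstClass (periodIso τ hτ)
      (ComplexTorus.latMonomial (periodIso τ hτ) 2 ![0, 1])) := by
  set b := singBasis τ hτ e with hb
  refine ⟨b.repr v 0, ?_⟩
  have hz : ∀ j : Fin 6, j ≠ 0 → b.repr v j = 0 := by
    intro j hj
    fin_cases j
    · exact absurd rfl hj
    · exact repr_eq_zero_of_fixed τ hτ he 2 h2 1 (by decide)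
    · exact repr_eq_zero_of_fixed τ hτ he 3 h3 2 (by decide)
    · exact repr_eq_zero_of_fixed τ hτ he 2 h2 3 (by decide)
    · exact repr_eq_zero_of_fixed τ hτ he 3 h3 4 (by decide)
    · exact repr_eq_zero_of_fixed τ hτ he 2 h2 5 (by decide)
  have hexp : v = ∑ i, b.repr v i • b i := (b.sum_repr v).symm
  rw [Fintype.sum_eq_single 0 (fun j hj ↦ by rw [hz j hj, zero_smul])] at hexp
  conv_lhs => rw [hexp]
  rw [hb, singBasis_apply, deRhamBasis_apply]
  rfl

include he in
/-- **The common fixed space of `x₀ ↦ -x₀` and `x₁ ↦ -x₁` is the line `ℂ · e[dx₂ ∧ dx₃]`.**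
[cite: LangeBirkenhake1992, §1.1.4] -/
theorem exists_eq_smul_of_fixed_zero_one {v : singularCohomology ℂ ℂ (Torus τ hτ) 2}
    (h0 : torusPullback τ hτ (signedPermMatrix (flipSign 0) 1) v = v)
    (h1 : torusPullback τ hτ (signedPermMatrix (flipSign 1) 1) v = v) :
    ∃ κ : ℂ, v = κ • deRhamIso τ hτ e (ComplexTorus.cconstClass (periodIso τ hτ)
      (ComplexTorus.latMonomial (periodIso τ hτ) 2 ![2, 3])) := by
  set b := singBasis τ hτ e with hb
  refine ⟨b.repr v 5, ?_⟩
  have hz : ∀ j : Fin 6, j ≠ 5 → b.repr v j = 0 := by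
    intro j hj
    fin_cases j
    · exact repr_eq_zero_of_fixed τ hτ he 0 h0 0 (by decide)
    · exact repr_eq_zero_of_fixed τ hτ he 0 h0 1 (by decide)
    · exact repr_eq_zero_of_fixed τ hτ he 0 h0 2 (by decide)
    · exact repr_eq_zero_of_fixed τ hτ he 1 h1 3 (by decide)
    · exact repr_eq_zero_of_fixed τ hτ he 1 h1 4 (by decide)
    · exact absurd rfl hj
  have hexp : v = ∑ i, b.repr v i • b i := (b.sum_repr v).symm
  rw [Fintype.sum_eq_single 5 (fun j hj ↦ by rw [hz j hj, zero_smul])] at hexp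
  conv_lhs => rw [hexp]
  rw [hb, singBasis_apply, deRhamBasis_apply]
  rfl

end Fixed

end WeilSquare

end Literature.AlgebraicGeometry.HodgeTheory

end
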